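import Literature.MathematicalPhysics.StatisticalMechanics.ComplexSpinRPWeightGaussianDomination
import Literature.MathematicalPhysics.StatisticalMechanics.ComplexSpinChiralLRO
import HarnessLib

/-!
# The infrared bound for complex spin systems with a GENERAL reflection-positive background weight
# (Fröhlich–Israel–Lieb–Simon 1978; Salmhofer–Seiler, CMP 139 (1991), (3.81)–(3.83), (3.98)–(3.99),
# (3.112)–(3.113))

Companion and continuation of `ComplexSpinRPWeightGaussianDomination`: there Gaussian domination
`|Z^±_W(φ)| ≤ |Z^±_W(0)|` was proved for the twisted partition functions of an ARBITRARY weight `W`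
that is reflection positive for all planes of the even torus.  Here the remaining steps of the
Fröhlich–Simon–Spencer / Salmhofer–Seiler chain are run for such a weight:

* **(3.81) for a general weight** `twistedZW_bg_eq`: if the background weight `W` and the weight
  `W₀` of the "original" system are related by `∏_j e_D^{K_j(0)} · W ≡ W₀` modulo the ideal
  `(σ_x^{N+1})` (`gaussFactor ε N`, the Gaussian factors `e^{-εNν∑σ_x²} e^{N∑σ_xσ_{x+e_μ}}` of
  `e^{-NH^ε_Λ(0)}`), then `Z^ε_W(φ) = e^{gaussConst} [e_D^{linObs(φ)}]_{W₀}` and `Z^ε_W(0) = [1]_{W₀}`;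
* the **second order** of Gaussian domination (3.98)/(3.99) for a REAL weight `W₀`
  (`bracketWR_sq_field_stencil_negOne_le`, `neg_le_bracketWR_sq_field_stencil_one`):
  `[σ(-Δφ)²]_{W₀} ≤ N⁻¹(φ,-Δφ)[1]_{W₀}` and `[σ(Δ̄φ)²]_{W₀} ≥ -N⁻¹(φ,Δ̄φ)[1]_{W₀}`;
* the **mode-wise infrared bound (3.112)–(3.113)** for the two-point kernel
  `G(x,y) = [σ_xσ_y]_{W₀}` of a translation-invariant real weight (`twoPtWR_mode_le`,
  `neg_twoPtWR_mode_le`): `2(ν - C(χ)) Re ĝ(χ) ≤ [1]_{W₀}/N` and `-2(ν + C(χ)) Re ĝ(χ) ≤ [1]_{W₀}/N`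
  for every character `χ` of the torus.

The hypotheses are exactly: `W` is an RP weight for every plane `(i, k)` (`IsRPWeight`), the
congruence `gaussFactor ε N * W ≡ W₀` (`TruncEq N`), `W₀` real, and (for the mode-wise form)
translation invariance of `G`.  The nearest-neighbour case of the tree (`bgSite`/`fluctCoeff`,
`twistedZ_bg_eq`, `twoPtHat_mode_le`) is the instance `W = boltzmannC N (bgSite ε N ν f) (fluctCoeff N a)`,
`W₀ = boltzmann N m a`.  Purpose (cell pub-ymgap, seat qcd-lit g21, ladder row Q1): for compact lattice
QED with one staggered fermion (`N = 1`) the `β`-dressed meson weight is such a `W₀` at EVERY `β ≥ 0`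
(its background weight is RP by `StaggeredGaugeGaussianCorrectedReflectionPositivity`), which is the
route to row S3 of the typed node `SalmhoferSeilerSmallBeta` beyond `β = 0`.  Honest framing:
finite-volume algebra of polynomial spin systems; nothing about the continuum or the summit's `QCD`
conjunct.  All proofs follow the cited tree files line by line with the weight abstracted.
0 facts, 0 sorry.

## References

* J. Fröhlich, R. Israel, E. H. Lieb, B. Simon, *Phase transitions and reflection positivity. I*,
  Commun. Math. Phys. 62 (1978) 1–34, §§2–4. [FrohlichIsraelLiebSimon1978]
* J. Fröhlich, B. Simon, T. Spencer, Commun. Math. Phys. 50 (1976) 79–95. [FrohlichSimonSpencer1976]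
* M. Salmhofer, E. Seiler, Commun. Math. Phys. 139 (1991) 395–432, (3.78)–(3.83), (3.98)–(3.99),
  (3.112)–(3.113). [SalmhoferSeiler1991]
* S. Friedli, Y. Velenik, *Statistical Mechanics of Lattice Systems*, CUP 2017, §10.5.3.
  [FriedliVelenik2017]
-/

noncomputable section

open MvPolynomial Finset

namespace Literature.MathematicalPhysics.StatisticalMechanics

open Literature.Probability.LatticeModels (TorusSite)
open Literature.Barriers.CriticalPhenomena.NonGibbs

namespace ComplexSpin

variable {ν L : ℕ} [NeZero L]

/-! ### The real bracket of a general real weight -/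

/-- **The coefficient-extraction bracket of a real weight** `W₀`: `[Φ]_{W₀} = ` the coefficient of
`∏_x σ_x^N` in `Φ · W₀` (Remark 3.2), real observables. [cite: SalmhoferSeiler1991, Remark 3.2] -/
def bracketWR (N : ℕ) (W₀ Φ : MvPolynomial (TorusSite ν L) ℝ) : ℝ :=
  coeff (topExponent N) (Φ * W₀)

/-- The complex bracket of the complexified weight on a complexified observable is the real bracket.
[cite: SalmhoferSeiler1991, Remark 3.2] -/
theorem bracketW_map_map (N : ℕ) (W₀ Φ : MvPolynomial (TorusSite ν L) ℝ) :
    bracketW N (MvPolynomial.map Complex.ofRealHom W₀) (MvPolynomial.map Complex.ofRealHom Φ) =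
      ((bracketWR N W₀ Φ : ℝ) : ℂ) := by
  rw [bracketW, bracketWR, ← map_mul, coeff_map]
  rfl

/-- `[·]_{W₀}` is additive. [cite: SalmhoferSeiler1991, Remark 3.2] -/
theorem bracketWR_add (N : ℕ) (W₀ Φ Ψ : MvPolynomial (TorusSite ν L) ℝ) :
    bracketWR N W₀ (Φ + Ψ) = bracketWR N W₀ Φ + bracketWR N W₀ Ψ := by
  rw [bracketWR, bracketWR, bracketWR, add_mul, coeff_add]

/-- `[∑ Φ_a]_{W₀} = ∑ [Φ_a]_{W₀}`. [cite: SalmhoferSeiler1991, Remark 3.2] -/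
theorem bracketWR_sum (N : ℕ) (W₀ : MvPolynomial (TorusSite ν L) ℝ) {α : Type*} (s : Finset α)
    (Φ : α → MvPolynomial (TorusSite ν L) ℝ) :
    bracketWR N W₀ (∑ b ∈ s, Φ b) = ∑ b ∈ s, bracketWR N W₀ (Φ b) := by
  rw [bracketWR, Finset.sum_mul, coeff_sum]
  rfl

/-- `[c Φ]_{W₀} = c [Φ]_{W₀}`. [cite: SalmhoferSeiler1991, Remark 3.2] -/
theorem bracketWR_C_mul (N : ℕ) (W₀ : MvPolynomial (TorusSite ν L) ℝ) (c : ℝ)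
    (Φ : MvPolynomial (TorusSite ν L) ℝ) :
    bracketWR N W₀ (C c * Φ) = c * bracketWR N W₀ Φ := by
  rw [bracketWR, bracketWR, mul_assoc, coeff_C_mul]

/-- **Bilinearity**: `[σ(u) σ(v)]_{W₀} = ∑_{x,y} u_x [σ_x σ_y]_{W₀} v_y`.
[cite: SalmhoferSeiler1991, (3.77) and (3.100)] -/
theorem bracketWR_field_mul_field (N : ℕ) (W₀ : MvPolynomial (TorusSite ν L) ℝ)
    (u v : TorusSite ν L → ℝ) :
    bracketWR N W₀ (field u * field v) = ∑ x, ∑ y, u x * bracketWR N W₀ (X x * X y) * v y := by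
  unfold field
  rw [Finset.sum_mul_sum, bracketWR_sum]
  refine Finset.sum_congr rfl fun x _ => ?_
  rw [bracketWR_sum]
  refine Finset.sum_congr rfl fun y _ => ?_
  rw [show C (u x) * X x * (C (v y) * X y) = C (u x * v y) * (X x * X y) by rw [map_mul]; ring,
    bracketWR_C_mul]
  ring

/-- **The bracket of the truncated exponential of a scaled linear observable is a polynomial in the
scale**: `[e_D^{z σ(ℓ)}]_{W₀} = ∑_{n ≤ D} z^n [σ(ℓ)^n]_{W₀} / n!`.
[cite: SalmhoferSeiler1991, (3.82)–(3.83) and (3.98)–(3.99)] -/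
theorem bracketW_eT_C_mul_map_field (N : ℕ) (W₀ : MvPolynomial (TorusSite ν L) ℝ) (z : ℂ)
    (ℓ : TorusSite ν L → ℝ) :
    bracketW N (MvPolynomial.map Complex.ofRealHom W₀)
        (eT (topDegree ν L N) (C z * MvPolynomial.map Complex.ofRealHom (field ℓ))) =
      ∑ n ∈ range (topDegree ν L N + 1),
        z ^ n * ((bracketWR N W₀ (field ℓ ^ n) / (n.factorial : ℝ) : ℝ) : ℂ) := by
  unfold eT
  rw [bracketW_sum]
  refine Finset.sum_congr rfl fun n _ => ?_
  rw [bracketW_C_mul, mul_pow, ← map_pow C, bracketW_C_mul, ← map_pow, bracketW_map_map]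
  push_cast
  ring

/-! ### (3.81) for a general background weight -/

/-- **The Gaussian factor** `∏_j e_D^{K_j(0)} = ∏_x e_D^{-εNνσ_x²} · ∏_{x,μ} e_D^{Nσ_xσ_{x+e_μ}}` of
`e^{-NH^ε_Λ(0)}`: multiplying the background weight of (3.78) by it gives back the original weight
(3.81). [cite: SalmhoferSeiler1991, (3.78)–(3.81)] -/
def gaussFactor (ε : ℤ) (N : ℕ) : FieldAlg ν L :=
  ∏ j, eT (topDegree ν L N) (hamFamily ε N (fun _ : TorusSite ν L => (0 : ℂ)) j)

/-- **(3.81) for a general background weight.**  If `∏_j e_D^{K_j(0)} · W ≡ W₀` modulo the ideal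
`(σ_x^{N+1})`, then the twisted partition function of the background weight `W` is
`Z^ε_W(φ) = exp(-(εN/2)∑(φ_x - εφ_{x+e_μ})²) · [e_D^{linObs ε N φ}]_{W₀}` (`ε = ±1`).
[cite: SalmhoferSeiler1991, (3.80)–(3.81)] -/
theorem twistedZW_bg_eq (ε : ℤ) (hε : ε = 1 ∨ ε = -1) (N : ℕ) {W W₀ : FieldAlg ν L}
    (hbg : TruncEq N (gaussFactor ε N * W) W₀) (φ : TorusSite ν L → ℂ) :
    twistedZW ε N W φ =
      Complex.exp (gaussConst ε N φ) * bracketW N W₀ (eT (topDegree ν L N) (linObs ε N φ)) := by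
  classical
  rw [twistedZW_eq ε hε, negNHam_decomp]
  dsimp only [cst, tail]
  have hcst : coeff 0 (C (gaussConst ε N φ) + linObs ε N φ +
      negNHam ε N (fun _ : TorusSite ν L => (0 : ℂ))) = gaussConst ε N φ := by
    rw [coeff_add, coeff_add, coeff_zero_C, coeff_zero_linObs, coeff_zero_negNHam_zero ε hε,
      add_zero, add_zero]
  rw [hcst, show C (gaussConst ε N φ) + linObs ε N φ + negNHam ε N (fun _ : TorusSite ν L => (0 : ℂ)) -
      C (gaussConst ε N φ) = linObs ε N φ + negNHam ε N (fun _ : TorusSite ν L => (0 : ℂ)) by ring]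
  refine congrArg₂ (· * ·) rfl ?_
  -- `e_D^{Lin + K₀} ≡ e_D^{Lin} · ∏_j e_D^{K₀,j}` under the bracket
  have hnull : NullEq (topDegree ν L N)
      (eT (topDegree ν L N) (linObs ε N φ + negNHam ε N (fun _ : TorusSite ν L => (0 : ℂ))))
      (eT (topDegree ν L N) (linObs ε N φ) * gaussFactor ε N) := by
    rw [gaussFactor, ← sum_hamFamily ε hε N]
    refine (eT_add_nullEq _ (coeff_zero_linObs ε N φ) ?_).trans
      ((NullEq.refl _).mul (eT_sum_nullEq _ _ fun j _ => coeff_zero_hamFamily_zero ε N j))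
    rw [coeff_sum]; exact Finset.sum_eq_zero fun j _ => coeff_zero_hamFamily_zero ε N j
  rw [← one_mul (eT (topDegree ν L N) (linObs ε N φ + _)), bracketW_congr_of_nullEq W hnull 1, one_mul,
    bracketW, bracketW, mul_assoc]
  exact TruncEq.coeff_topExponent_eq ((TruncEq.refl _).mul hbg)

/-- **`Z^ε_W(0) = [1]_{W₀}`** ("then `Z^ε_Λ(0) = Z_Λ`", p. 413).
[cite: SalmhoferSeiler1991, (3.80)–(3.81)] -/
theorem twistedZW_bg_zero (ε : ℤ) (hε : ε = 1 ∨ ε = -1) (N : ℕ) {W W₀ : FieldAlg ν L}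
    (hbg : TruncEq N (gaussFactor ε N * W) W₀) :
    twistedZW ε N W (fun _ : TorusSite ν L => (0 : ℂ)) = bracketW N W₀ 1 := by
  rw [twistedZW_bg_eq ε hε N hbg, gaussConst_zero, linObs_zero, eT_zero, Complex.exp_zero, one_mul]

/-- **`[1]_{W₀} ≥ 0`**: it is the twisted partition function at `φ = 0` of the RP background weight
(torus of positive dimension). [cite: SalmhoferSeiler1991, (3.80)–(3.81) and (3.90)] -/
theorem bracketWR_one_nonneg (hL : Even L) (i : Fin ν) (ε : ℤ) (hε : ε = 1 ∨ ε = -1) {N : ℕ}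
    {W : FieldAlg ν L} (hW : IsRPWeight i 0 N W) {W₀ : MvPolynomial (TorusSite ν L) ℝ}
    (hbg : TruncEq N (gaussFactor ε N * W) (MvPolynomial.map Complex.ofRealHom W₀)) :
    0 ≤ bracketWR N W₀ 1 ∧
      twistedZW ε N W (fun _ : TorusSite ν L => (0 : ℂ)) = ((bracketWR N W₀ 1 : ℝ) : ℂ) := by
  have hZ : twistedZW ε N W (fun _ : TorusSite ν L => (0 : ℂ)) = ((bracketWR N W₀ 1 : ℝ) : ℂ) := by
    rw [twistedZW_bg_zero ε hε N hbg, ← bracketW_map_map, map_one]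
  refine ⟨?_, hZ⟩
  have h := (twistedZW_zero_real hL i 0 ε hW).2
  rwa [hZ, Complex.ofReal_re] at h

/-! ### Gaussian domination to second order: the two quadratic-form bounds -/

/-- **(3.98) to second order for a general weight**: `[σ(-Δφ)²]_{W₀} ≤ N⁻¹ (φ, -Δφ) [1]_{W₀}` for
every real `φ` — Gaussian domination (3.95) for the RP background weight `W`, the identification
(3.81)/(3.82), and comparison of the `t²`-coefficients.
[cite: SalmhoferSeiler1991, (3.82), (3.95), (3.98)] -/
theorem bracketWR_sq_field_stencil_negOne_le (hL : Even L) (i : Fin ν)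
    (hcard : 2 ≤ Fintype.card (TorusSite ν L)) {N : ℕ} (hN : 1 ≤ N) {W : FieldAlg ν L}
    (hW : ∀ (i : Fin ν) (k : ZMod L), IsRPWeight i k N W) {W₀ : MvPolynomial (TorusSite ν L) ℝ}
    (hbg : TruncEq N (gaussFactor 1 N * W) (MvPolynomial.map Complex.ofRealHom W₀))
    (φ : TorusSite ν L → ℝ) :
    bracketWR N W₀ (field (stencil (-1) φ) ^ 2) ≤
      (1 / N) * (∑ x, φ x * stencil (-1) φ x) * bracketWR N W₀ 1 := by
  set ℓ : TorusSite ν L → ℝ := fun x => (N : ℝ) * stencil (-1) φ x with hℓ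
  set Q : ℝ := ∑ x, φ x * stencil (-1) φ x with hQ
  set Z : ℝ := bracketWR N W₀ 1 with hZdef
  obtain ⟨hZ0, hZ⟩ := bracketWR_one_nonneg hL i 1 (Or.inl rfl) (hW i 0) hbg
  have hD2 := two_mul_le_topDegree (N := N) hcard
  have hQ0 : 0 ≤ Q := by
    rw [hQ, ← sum_sq_link_eq (-1) (Or.inr rfl) φ]; positivity
  have hNpos : (0 : ℝ) < N := Nat.cast_pos.2 hN
  -- the polynomial `t ↦ [e_D^{t σ(ℓ)}]` and its exponential bound
  set p : ℕ → ℝ := fun n => bracketWR N W₀ (field ℓ ^ n) / (n.factorial : ℝ) with hp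
  have hp0 : p 0 = Z := by simp [hp, hZdef]
  have hbound : ∀ t : ℝ, |∑ n ∈ range (topDegree ν L N + 1), p n * t ^ n| ≤
      p 0 * Real.exp ((N : ℝ) / 2 * Q * t ^ 2) := by
    intro t
    set φt : TorusSite ν L → ℂ := fun y => (((t * φ y : ℝ)) : ℂ) with hφt
    have hgd := gaussianDominationW_one hL hW (φ := φt)
      (fun y => by rw [hφt]; exact Complex.conj_ofReal _)
    rw [hZ, twistedZW_bg_eq 1 (Or.inl rfl) N hbg φt] at hgd
    have hg : gaussConst 1 N φt = ((-((N : ℝ) / 2) * Q * t ^ 2 : ℝ) : ℂ) := by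
      rw [hφt, gaussConst_one_ofReal]
      congr 1
      simp only [stencil_smul]
      rw [show -((N : ℝ) / 2) * Q * t ^ 2 = (-((N : ℝ) / 2) * t ^ 2) * Q by ring, hQ,
        Finset.mul_sum, Finset.mul_sum]
      exact Finset.sum_congr rfl fun x _ => by ring
    have hlin : linObs 1 N φt = C ((t : ℝ) : ℂ) * MvPolynomial.map Complex.ofRealHom (field ℓ) := by
      rw [hφt, linObs_one_ofReal]
      have : (fun x => (N : ℝ) * stencil (-1) (fun y => t * φ y) x) = fun x => t * ℓ x := by
        funext x; rw [stencil_smul, hℓ]; ring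
      rw [this, field_smul, map_mul, map_C]
      rfl
    rw [hg, hlin, bracketW_eT_C_mul_map_field, norm_mul, Complex.norm_exp, Complex.ofReal_re,
      Complex.norm_real, Real.norm_of_nonneg hZ0] at hgd
    have hsum : ∑ n ∈ range (topDegree ν L N + 1), ((t : ℝ) : ℂ) ^ n *
        ((bracketWR N W₀ (field ℓ ^ n) / (n.factorial : ℝ) : ℝ) : ℂ) =
        ((∑ n ∈ range (topDegree ν L N + 1), p n * t ^ n : ℝ) : ℂ) := by
      push_cast
      exact Finset.sum_congr rfl fun n _ => by rw [hp]; push_cast; ring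
    rw [hsum, Complex.norm_real, Real.norm_eq_abs] at hgd
    rw [hp0]
    have hexp : 0 < Real.exp (-((N : ℝ) / 2) * Q * t ^ 2) := Real.exp_pos _
    have h3 := (le_div_iff₀' hexp).2 hgd
    rw [div_eq_mul_inv, ← Real.exp_neg,
      show -(-((N : ℝ) / 2) * Q * t ^ 2) = (N : ℝ) / 2 * Q * t ^ 2 by ring] at h3
    exact h3
  have h2 := coeff_two_le_of_abs_sum_le_exp (le_trans (by omega) hD2) p
    (by positivity : 0 ≤ (N : ℝ) / 2 * Q) (by rw [hp0]; exact hZ0) hbound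
  rw [hp0] at h2
  simp only [hp, Nat.factorial_two, Nat.cast_ofNat] at h2
  -- `[σ(ℓ)²] = N² [σ(Tφ)²]`
  have hℓ2 : bracketWR N W₀ (field ℓ ^ 2) =
      (N : ℝ) ^ 2 * bracketWR N W₀ (field (stencil (-1) φ) ^ 2) := by
    rw [hℓ, field_smul, mul_pow, ← map_pow, bracketWR_C_mul]
  rw [hℓ2] at h2
  have h3 : (N : ℝ) * bracketWR N W₀ (field (stencil (-1) φ) ^ 2) ≤ Q * Z :=
    le_of_mul_le_mul_left (by linarith) hNpos
  have h4 : bracketWR N W₀ (field (stencil (-1) φ) ^ 2) ≤ Q * Z / N := (le_div_iff₀' hNpos).2 h3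
  calc bracketWR N W₀ (field (stencil (-1) φ) ^ 2) ≤ Q * Z / N := h4
    _ = 1 / N * Q * Z := by ring

/-- **(3.99) to second order for a general weight**: `[σ(Δ̄φ)²]_{W₀} ≥ -N⁻¹ (φ, Δ̄φ) [1]_{W₀}` for
every real `φ` — Gaussian domination (3.97) at the imaginary configuration `iφ` for the RP background
weight `W`, the identification (3.81)/(3.83), and the real part to second order.
[cite: SalmhoferSeiler1991, (3.83), (3.97), (3.99)] -/
theorem neg_le_bracketWR_sq_field_stencil_one (hL : Even L) (i : Fin ν)
    (hcard : 2 ≤ Fintype.card (TorusSite ν L)) {N : ℕ} (hN : 1 ≤ N) {W : FieldAlg ν L}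
    (hW : ∀ (i : Fin ν) (k : ZMod L), IsRPWeight i k N W) {W₀ : MvPolynomial (TorusSite ν L) ℝ}
    (hbg : TruncEq N (gaussFactor (-1) N * W) (MvPolynomial.map Complex.ofRealHom W₀))
    (φ : TorusSite ν L → ℝ) :
    -((1 / N) * (∑ x, φ x * stencil 1 φ x) * bracketWR N W₀ 1) ≤
      bracketWR N W₀ (field (stencil 1 φ) ^ 2) := by
  set ℓ : TorusSite ν L → ℝ := fun x => (N : ℝ) * stencil 1 φ x with hℓ
  set Q : ℝ := ∑ x, φ x * stencil 1 φ x with hQ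
  set Z : ℝ := bracketWR N W₀ 1 with hZdef
  obtain ⟨hZ0, hZ⟩ := bracketWR_one_nonneg hL i (-1) (Or.inr rfl) (hW i 0) hbg
  have hD2 := two_mul_le_topDegree (N := N) hcard
  have hQ0 : 0 ≤ Q := by
    rw [hQ, ← sum_sq_link_eq 1 (Or.inl rfl) φ]; positivity
  have hNpos : (0 : ℝ) < N := Nat.cast_pos.2 hN
  -- the real parts `p_n = Re((-i)^n) [σ(ℓ)^n]/n!`
  set p : ℕ → ℝ := fun n => ((-Complex.I) ^ n).re * (bracketWR N W₀ (field ℓ ^ n) / (n.factorial : ℝ))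
    with hp
  have hp0 : p 0 = Z := by simp [hp, hZdef]
  have hbound : ∀ t : ℝ, |∑ n ∈ range (topDegree ν L N + 1), p n * t ^ n| ≤
      p 0 * Real.exp ((N : ℝ) / 2 * Q * t ^ 2) := by
    intro t
    set φt : TorusSite ν L → ℂ := fun y => (((t * φ y : ℝ)) : ℂ) * Complex.I with hφt
    have hgd := gaussianDominationW_negOne hL hW (φ := φt)
      (fun y => by rw [hφt, map_mul, Complex.conj_ofReal, Complex.conj_I, mul_neg])
    rw [hZ, twistedZW_bg_eq (-1) (Or.inr rfl) N hbg φt] at hgd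
    have hg : gaussConst (-1) N φt = ((-((N : ℝ) / 2) * Q * t ^ 2 : ℝ) : ℂ) := by
      rw [hφt]
      have := gaussConst_negOne_I (ν := ν) (L := L) N (fun y => t * φ y)
      rw [show (fun y : TorusSite ν L => (((t * φ y : ℝ)) : ℂ) * Complex.I) =
          fun y => (((fun y => t * φ y) y : ℝ) : ℂ) * Complex.I from rfl, this]
      congr 1
      simp only [stencil_smul]
      rw [show -((N : ℝ) / 2) * Q * t ^ 2 = (-((N : ℝ) / 2) * t ^ 2) * Q by ring, hQ,
        Finset.mul_sum, Finset.mul_sum]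
      exact Finset.sum_congr rfl fun x _ => by ring
    have hlin : linObs (-1) N φt =
        C (-Complex.I * ((t : ℝ) : ℂ)) * MvPolynomial.map Complex.ofRealHom (field ℓ) := by
      rw [hφt]
      have := linObs_negOne_I (ν := ν) (L := L) N (fun y => t * φ y)
      rw [show (fun y : TorusSite ν L => (((t * φ y : ℝ)) : ℂ) * Complex.I) =
          fun y => (((fun y => t * φ y) y : ℝ) : ℂ) * Complex.I from rfl, this]
      have : (fun x => (N : ℝ) * stencil 1 (fun y => t * φ y) x) = fun x => t * ℓ x := by
        funext x; rw [stencil_smul, hℓ]; ring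
      rw [this, field_smul, map_mul, map_C, ← mul_assoc, ← map_mul]
      rfl
    rw [hg, hlin, bracketW_eT_C_mul_map_field, norm_mul, Complex.norm_exp, Complex.ofReal_re,
      Complex.norm_real, Real.norm_of_nonneg hZ0] at hgd
    -- pass to the real part
    have hre : (∑ n ∈ range (topDegree ν L N + 1), (-Complex.I * ((t : ℝ) : ℂ)) ^ n *
        ((bracketWR N W₀ (field ℓ ^ n) / (n.factorial : ℝ) : ℝ) : ℂ)).re =
        ∑ n ∈ range (topDegree ν L N + 1), p n * t ^ n := by
      rw [Complex.re_sum]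
      refine Finset.sum_congr rfl fun n _ => ?_
      rw [hp, mul_pow, ← Complex.ofReal_pow, mul_assoc, ← Complex.ofReal_mul, Complex.re_mul_ofReal]
      ring
    have hexp : 0 < Real.exp (-((N : ℝ) / 2) * Q * t ^ 2) := Real.exp_pos _
    have hle := (mul_le_mul_of_nonneg_left (Complex.abs_re_le_norm _) hexp.le).trans hgd
    rw [hre] at hle
    rw [hp0]
    have h3 := (le_div_iff₀' hexp).2 hle
    rw [div_eq_mul_inv, ← Real.exp_neg,
      show -(-((N : ℝ) / 2) * Q * t ^ 2) = (N : ℝ) / 2 * Q * t ^ 2 by ring] at h3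
    exact h3
  have h2 := coeff_two_le_of_abs_sum_le_exp (le_trans (by omega) hD2) p
    (by positivity : 0 ≤ (N : ℝ) / 2 * Q) (by rw [hp0]; exact hZ0) hbound
  rw [hp0] at h2
  have hI2 : ((-Complex.I) ^ 2).re = -1 := by
    rw [neg_sq, Complex.I_sq]; simp
  simp only [hp, hI2, Nat.factorial_two, Nat.cast_ofNat] at h2
  have hℓ2 : bracketWR N W₀ (field ℓ ^ 2) =
      (N : ℝ) ^ 2 * bracketWR N W₀ (field (stencil 1 φ) ^ 2) := by
    rw [hℓ, field_smul, mul_pow, ← map_pow, bracketWR_C_mul]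
  rw [hℓ2] at h2
  have h3 : (N : ℝ) * (-bracketWR N W₀ (field (stencil 1 φ) ^ 2)) ≤ Q * Z :=
    le_of_mul_le_mul_left (by linarith) hNpos
  have h4 : -bracketWR N W₀ (field (stencil 1 φ) ^ 2) ≤ Q * Z / N := (le_div_iff₀' hNpos).2 h3
  have h5 : (1 : ℝ) / N * Q * Z = Q * Z / N := by ring
  rw [h5]
  linarith

/-! ### The two-point kernel of a real weight and the infrared bound mode by mode (3.112)–(3.113) -/

/-- The (unnormalised) two-point function `G(x,y) = [σ_x σ_y]_{W₀}` of a real weight, as a kernel on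
the torus. [cite: SalmhoferSeiler1991, (3.100)] -/
def twoPtWR (N : ℕ) (W₀ : MvPolynomial (TorusSite ν L) ℝ) (x y : TorusSite ν L) : ℝ :=
  bracketWR N W₀ (X x * X y)

/-- `G` is symmetric. [cite: SalmhoferSeiler1991, (3.100)] -/
theorem twoPtWR_comm (N : ℕ) (W₀ : MvPolynomial (TorusSite ν L) ℝ) (x y : TorusSite ν L) :
    twoPtWR N W₀ x y = twoPtWR N W₀ y x := by
  rw [twoPtWR, twoPtWR, mul_comm]

/-- **(3.112)–(3.113), first half, for a general weight**: `2(ν - C(χ)) Re ĝ(χ) ≤ [1]_{W₀}/N` for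
every character `χ`, where `ĝ` is the symbol of the translation-invariant kernel
`G(x,y) = [σ_xσ_y]_{W₀}` (Gaussian domination (3.98) to second order, diagonalised).
[cite: SalmhoferSeiler1991, (3.112)–(3.113)] -/
theorem twoPtWR_mode_le (hL : Even L) (i : Fin ν) (hcard : 2 ≤ Fintype.card (TorusSite ν L))
    {N : ℕ} (hN : 1 ≤ N) {W : FieldAlg ν L} (hW : ∀ (i : Fin ν) (k : ZMod L), IsRPWeight i k N W)
    {W₀ : MvPolynomial (TorusSite ν L) ℝ}
    (hbg : TruncEq N (gaussFactor 1 N * W) (MvPolynomial.map Complex.ofRealHom W₀))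
    (hT : ∀ x y c : TorusSite ν L, twoPtWR N W₀ (x + c) (y + c) = twoPtWR N W₀ x y)
    (χ : AddChar (TorusSite ν L) ℂ) :
    2 * ((ν : ℝ) - cosSum χ) * (kernelSymbol (twoPtWR N W₀) χ).re ≤ (1 / N) * bracketWR N W₀ 1 := by
  have hZ0 : 0 ≤ bracketWR N W₀ 1 := (bracketWR_one_nonneg hL i 1 (Or.inl rfl) (hW i 0) hbg).1
  have hκ : 0 ≤ 1 / (N : ℝ) * bracketWR N W₀ 1 := by positivity
  have hA : ∀ φ : TorusSite ν L → ℝ,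
      ∑ x, ∑ y, stencil (-1) φ x * twoPtWR N W₀ x y * stencil (-1) φ y ≤
        (1 / (N : ℝ) * bracketWR N W₀ 1) * ∑ x, φ x * stencil (-1) φ x := by
    intro φ
    have h1 := bracketWR_sq_field_stencil_negOne_le hL i hcard hN hW hbg φ
    rw [sq, bracketWR_field_mul_field] at h1
    unfold twoPtWR
    linarith
  have h := symbolRe_mul_kernelSymbol_le (s := -1) (by norm_num) hT (twoPtWR_comm N W₀) hκ hA χ
  rw [symbolRe_neg_one] at h
  exact h

/-- **(3.112)–(3.113), second half, for a general weight**: `-2(ν + C(χ)) Re ĝ(χ) ≤ [1]_{W₀}/N` for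
every character `χ` ((3.99) to second order, diagonalised). [cite: SalmhoferSeiler1991, (3.112)–(3.113)] -/
theorem neg_twoPtWR_mode_le (hL : Even L) (i : Fin ν) (hcard : 2 ≤ Fintype.card (TorusSite ν L))
    {N : ℕ} (hN : 1 ≤ N) {W : FieldAlg ν L} (hW : ∀ (i : Fin ν) (k : ZMod L), IsRPWeight i k N W)
    {W₀ : MvPolynomial (TorusSite ν L) ℝ}
    (hbg : TruncEq N (gaussFactor (-1) N * W) (MvPolynomial.map Complex.ofRealHom W₀))
    (hT : ∀ x y c : TorusSite ν L, twoPtWR N W₀ (x + c) (y + c) = twoPtWR N W₀ x y)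
    (χ : AddChar (TorusSite ν L) ℂ) :
    2 * ((ν : ℝ) + cosSum χ) * (-(kernelSymbol (twoPtWR N W₀) χ).re) ≤ (1 / N) * bracketWR N W₀ 1 := by
  have hZ0 : 0 ≤ bracketWR N W₀ 1 := (bracketWR_one_nonneg hL i (-1) (Or.inr rfl) (hW i 0) hbg).1
  have hκ : 0 ≤ 1 / (N : ℝ) * bracketWR N W₀ 1 := by positivity
  set G' : TorusSite ν L → TorusSite ν L → ℝ := fun x y => -twoPtWR N W₀ x y with hG'
  have hT' : ∀ x y c : TorusSite ν L, G' (x + c) (y + c) = G' x y := fun x y c => by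
    simp only [hG', hT]
  have hS' : ∀ x y : TorusSite ν L, G' x y = G' y x := fun x y => by
    simp only [hG', twoPtWR_comm N W₀ x y]
  have hA : ∀ φ : TorusSite ν L → ℝ,
      ∑ x, ∑ y, stencil 1 φ x * G' x y * stencil 1 φ y ≤
        (1 / (N : ℝ) * bracketWR N W₀ 1) * ∑ x, φ x * stencil 1 φ x := by
    intro φ
    have h1 := neg_le_bracketWR_sq_field_stencil_one hL i hcard hN hW hbg φ
    rw [sq, bracketWR_field_mul_field] at h1
    have : ∑ x, ∑ y, stencil 1 φ x * G' x y * stencil 1 φ y =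
        -∑ x, ∑ y, stencil 1 φ x * bracketWR N W₀ (X x * X y) * stencil 1 φ y := by
      rw [← Finset.sum_neg_distrib]
      refine Finset.sum_congr rfl fun x _ => ?_
      rw [← Finset.sum_neg_distrib]
      exact Finset.sum_congr rfl fun y _ => by simp only [hG', twoPtWR]; ring
    rw [this]
    linarith
  have h := symbolRe_mul_kernelSymbol_le (s := 1) (by norm_num) hT' hS' hκ hA χ
  have hsym : (kernelSymbol G' χ).re = -(kernelSymbol (twoPtWR N W₀) χ).re := by
    simp only [hG', kernelSymbol, Complex.ofReal_neg, neg_mul, Finset.sum_neg_distrib, Complex.neg_re]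
  rw [symbolRe_one, hsym] at h
  exact h

end ComplexSpin

end Literature.MathematicalPhysics.StatisticalMechanics

end
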